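import Summits.HubbardSuperconductivity.HubbardSuperconductivity.Theorems.CooperPairDMottWalkCooperPairDMottPlaquetteGCWindow

/-!
# Route `CooperPairDMottWalk`, crux `CooperPairDMott`: the odd-sector floor of the plaquette

Stub `stub_plaquetteOddSectorFloor` of the line `Cruxes/CooperPairDMott/Lines/birth.lean` (item
stmt-HubbardSuperconductivity-1177, reshape 4), the plaquette datum of the holon floor
(`holonBandFloor_of_relativeBound`). For `U ∈ [2, 4]`, `h = hubbardTorus 2 2 1 U` (the 4-cycle with
hopping `1`), `μ = U/2` (particle–hole symmetric), `e₄ = minEnergyOn h (szSector 4 0)`,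
`e₃ = minEnergyOn h (szSector 3 ½)` (the minimum of the sector `(N↑, N↓) = (2, 1)`):
 (i) `Re⟨v, (h − μN) v⟩ ≥ (e₄ − 2U)‖v‖²` on every sector `(a, b)`: off `(2, 2)` the certified window
     `gcWindow_offSector` (`…PlaquetteGCWindow`, margin `1/20` dropped), on `(2, 2)` the variational
     floor `upDownSector_groundState`;
 (ii) `Re⟨v, h v⟩ ≥ (e₃ + μ(a + b − 3))‖v‖²` on every ODD sector: `(2,1)` is the definition of `e₃`;
     `(1,2)` is its image under the SPIN EXCHANGE `(x,σ) ↦ (x,1−σ)` (`sectorFormBound_spinSwap`: the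
     signed permutation unitary `relabelMatrix Orb.spinSwap` is an isometry commuting with `h` mapping
     the sector `(a,b)` onto `(b,a)`); `(2,3)`, `(3,2)` are the PARTICLE–HOLE images of `(2,1)`, `(1,2)`
     (`sectorFormBound_particleHole`: on a bipartite graph `Pᴴ` maps `(a,b)` to `(|Λ|−a, |Λ|−b)`
     isometrically and `P h Pᴴ = h − UN + U|Λ|`), floor `e₃ + U` EXACTLY; the other odd sectors have
     Gershgorin floors (`plaq10_lb`, `plaq30_lb`: `−2`; `plaq41_lb`: `U − 2`; `plaq43_lb`: `3U − 2`)
     beating the required `e₃ − U`, `e₃`, `e₃ + U`, `e₃ + 2U` because `e₃ ≤ −2` (variational ceiling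
     `e3_le_trial`: `e₃ ≤ (−55 + 4U)/15 ≤ −2.6` from an integer trial array);
 (iii) `e₄ − U/2 < e₃`: the affine ceiling `e4_le_2` on `e₄` against the certified floor `−3.211 ≤ e₃`
     (`form21_lb_0`, monotone in `U`); margin `≥ 0.55`.
Numerically (uncertified): `e₃ = −3.209 … −2.752`, `e₄ = −2.828 … −2.103` on `[2, 4]`.
Sources: E. H. Lieb, PRL 62 (1989) 1201 (sectors, particle–hole map); W.-F. Tsai, S. A. Kivelson,
PRB 73 (2006) 214510, Table I; Bratteli–Robinson II, Thm. 5.2.5 (implemented orbital bijections).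
All statements are [folklore]; no definition is introduced.
-/

set_option linter.dupNamespace false

noncomputable section

namespace Summit.HubbardSuperconductivity.HubbardSuperconductivity.Theorems.CooperPairDMottWalk

open Literature.MathematicalPhysics.QuantumLattice Literature.MathematicalPhysics.QuantumLattice.TwoSpecies
open Matrix Finset Literature.Hubbard
open scoped ComplexOrder

/-! ### Spin exchange and particle–hole conjugation at the level of the sectors `(N↑, N↓)` -/

section Symmetry

/-- `spinSwap⁻¹ (x, σ) = (x, swap σ)` (the spin exchange is an involution). [folklore] -/
theorem spinSwap_symm_orb {Λ : Type*} (x : Λ) (σ : Fin 2) :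
    (Orb.spinSwap : Orb Λ ≃ Orb Λ).symm (orb x σ) = orb x (Equiv.swap (0 : Fin 2) 1 σ) := by
  rw [Equiv.symm_apply_eq, Orb.spinSwap_orb, Equiv.swap_apply_self]

variable {Λ : Type*} [LinearOrder Λ] [Fintype Λ]

/-- The up-spin sites of a spin-exchanged configuration are the down-spin sites. [folklore] -/
theorem upPart_finsetCongr_spinSwap (s : Finset (Orb Λ)) :
    upPart ((Orb.spinSwap : Orb Λ ≃ Orb Λ).finsetCongr s) = downPart s := by
  ext x
  rw [mem_upPart, Equiv.finsetCongr_apply, Finset.mem_map_equiv, spinSwap_symm_orb,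
    Equiv.swap_apply_left, mem_downPart]

/-- The down-spin sites of a spin-exchanged configuration are the up-spin sites. [folklore] -/
theorem downPart_finsetCongr_spinSwap (s : Finset (Orb Λ)) :
    downPart ((Orb.spinSwap : Orb Λ ≃ Orb Λ).finsetCongr s) = upPart s := by
  ext x
  rw [mem_downPart, Equiv.finsetCongr_apply, Finset.mem_map_equiv, spinSwap_symm_orb,
    Equiv.swap_apply_right, mem_upPart]

/-- **The spin-exchange unitary maps the sector `(a, b)` to the sector `(b, a)`.** [folklore] -/
theorem isInSector_spinSwap_mulVec {a b : ℕ} {ψ : Fock (Orb Λ)} (hψ : IsInSector a b ψ) :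
    IsInSector b a (relabelMatrix (Orb.spinSwap : Orb Λ ≃ Orb Λ) *ᵥ ψ) := by
  intro s' hs'
  obtain ⟨s, rfl⟩ := (Orb.spinSwap : Orb Λ ≃ Orb Λ).finsetCongr.surjective s'
  rw [relabelMatrix_mulVec_apply, hψ s, mul_zero]
  rw [upPart_finsetCongr_spinSwap, downPart_finsetCongr_spinSwap] at hs'
  exact fun h => hs' ⟨h.2, h.1⟩

variable (G : SimpleGraph Λ) [DecidableRel G.Adj]

/-- Spin-exchange invariance of the Hubbard Hamiltonian (the `μ = 0` case of
`relabel_spinSwap_hamiltonianWith`). [folklore] -/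
theorem relabel_spinSwap_hamiltonian (t U : ℝ) :
    relabel (Orb.spinSwap : Orb Λ ≃ Orb Λ) (hamiltonian G t U) = hamiltonian G t U := by
  have h := relabel_spinSwap_hamiltonianWith G t U 0
  simp only [hamiltonianWith, Complex.ofReal_zero, zero_smul, sub_zero] at h
  exact h

/-- The spin-exchange unitary intertwines the Hubbard Hamiltonian: `H (Γ ψ) = Γ (H ψ)`. [folklore] -/
theorem hamiltonian_mulVec_spinSwap (t U : ℝ) (ψ : Fock (Orb Λ)) :
    hamiltonian G t U *ᵥ (relabelMatrix (Orb.spinSwap : Orb Λ ≃ Orb Λ) *ᵥ ψ) =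
      relabelMatrix (Orb.spinSwap : Orb Λ ≃ Orb Λ) *ᵥ (hamiltonian G t U *ᵥ ψ) := by
  have h := relabel_mulVec_relabelMatrix_mulVec (Orb.spinSwap : Orb Λ ≃ Orb Λ) (hamiltonian G t U) ψ
  rwa [relabel_spinSwap_hamiltonian] at h

/-- **Spin-exchange transport of sector form bounds**: a lower bound `E‖φ‖² ≤ Re⟨φ, Hφ⟩` on the
sector `(a, b)` holds on the mirrored sector `(b, a)` (`Γ` is an isometry commuting with `H`).
Lieb, PRL 62 (1989) 1201 (spin up–down symmetry of the sectors). [folklore] -/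
theorem sectorFormBound_spinSwap (t U : ℝ) {a b : ℕ} {E : ℝ}
    (h : ∀ φ : Fock (Orb Λ), IsInSector a b φ →
      E * (star φ ⬝ᵥ φ).re ≤ (star φ ⬝ᵥ (hamiltonian G t U *ᵥ φ)).re)
    (φ : Fock (Orb Λ)) (hφ : IsInSector b a φ) :
    E * (star φ ⬝ᵥ φ).re ≤ (star φ ⬝ᵥ (hamiltonian G t U *ᵥ φ)).re := by
  have h1 := h _ (isInSector_spinSwap_mulVec hφ)
  rwa [hamiltonian_mulVec_spinSwap, star_relabelMatrix_mulVec_dotProduct,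
    star_relabelMatrix_mulVec_dotProduct] at h1

/-- Up-spin sites of the complementary configuration. [folklore] -/
theorem upPart_compl (s : Finset (Orb Λ)) : upPart sᶜ = (upPart s)ᶜ := by
  ext x; simp only [mem_upPart, Finset.mem_compl]

/-- Down-spin sites of the complementary configuration. [folklore] -/
theorem downPart_compl (s : Finset (Orb Λ)) : downPart sᶜ = (downPart s)ᶜ := by
  ext x; simp only [mem_downPart, Finset.mem_compl]

/-- **The (adjoint) particle–hole transformation maps the sector `(a, b)` to `(|Λ| − a, |Λ| − b)`**
(`(Pᴴψ)(t) ∝ ψ(tᶜ)`). Lieb, PRL 62 (1989) 1201. [folklore] -/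
theorem isInSector_particleHole_conjTranspose_mulVec (ε : Orb Λ → ℂ) {a b : ℕ} {ψ : Fock (Orb Λ)}
    (hψ : IsInSector a b ψ) :
    IsInSector (Fintype.card Λ - a) (Fintype.card Λ - b) ((particleHole ε)ᴴ *ᵥ ψ) := by
  intro t ht
  rw [particleHole_conjTranspose_mulVec_apply, hψ _, mul_zero]
  rw [upPart_compl, downPart_compl, Finset.card_compl, Finset.card_compl]
  have hu := (upPart t).card_le_univ
  have hd := (downPart t).card_le_univ
  rintro ⟨ha, hb⟩
  exact ht ⟨by omega, by omega⟩

/-- **Particle–hole transport of sector form bounds** on a graph with a bipartite sign `ε`: a lower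
bound `E‖ψ‖² ≤ Re⟨ψ, Hψ⟩` on the sector `(|Λ| − a, |Λ| − b)` gives
`(E + U(a + b − |Λ|))‖φ‖² ≤ Re⟨φ, Hφ⟩` on the sector `(a, b)` (`Pᴴ` is an isometry between the two
sectors and `P H Pᴴ = H − UN + U|Λ|`). Lieb, PRL 62 (1989) 1201; Lieb–Wu, Physica A 321 (2003) 1,
eq. (3). [folklore] -/
theorem sectorFormBound_particleHole (t U : ℝ) (ε : Λ → ℤˣ)
    (hε : ∀ x y, G.Adj x y → ε x = -ε y) {a b : ℕ} {E : ℝ}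
    (h : ∀ ψ : Fock (Orb Λ), IsInSector (Fintype.card Λ - a) (Fintype.card Λ - b) ψ →
      E * (star ψ ⬝ᵥ ψ).re ≤ (star ψ ⬝ᵥ (hamiltonian G t U *ᵥ ψ)).re)
    (φ : Fock (Orb Λ)) (hφ : IsInSector a b φ) :
    (E + U * (((a + b : ℕ) : ℝ) - Fintype.card Λ)) * (star φ ⬝ᵥ φ).re ≤
      (star φ ⬝ᵥ (hamiltonian G t U *ᵥ φ)).re := by
  set ε' : Orb Λ → ℂ := fun i => ((ε (ofLex i).1 : ℤ) : ℂ) with hε'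
  have hn : ∀ i, ‖ε' i‖ = 1 := fun i => norm_intCast_units _
  set P := particleHole ε' with hP
  have hconj : P * hamiltonian G t U * Pᴴ =
      hamiltonian G t U - (U : ℂ) • totalNumber + ((U * Fintype.card Λ : ℝ) : ℂ) • 1 :=
    hamiltonian_particleHole_bipartite_holds G t U ε hε
  have hψ : IsInSector (Fintype.card Λ - a) (Fintype.card Λ - b) (Pᴴ *ᵥ φ) :=
    isInSector_particleHole_conjTranspose_mulVec ε' hφ
  have h1 := h _ hψ
  have hnorm : star (Pᴴ *ᵥ φ) ⬝ᵥ (Pᴴ *ᵥ φ) = star φ ⬝ᵥ φ := by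
    rw [star_mulVec, conjTranspose_conjTranspose, ← dotProduct_mulVec, mulVec_mulVec,
      particleHole_mul_conjTranspose ε' hn, one_mulVec]
  have hform : star (Pᴴ *ᵥ φ) ⬝ᵥ (hamiltonian G t U *ᵥ (Pᴴ *ᵥ φ)) =
      star φ ⬝ᵥ (hamiltonian G t U *ᵥ φ) - (U : ℂ) * ((a + b : ℕ) : ℂ) * (star φ ⬝ᵥ φ) +
        ((U * Fintype.card Λ : ℝ) : ℂ) * (star φ ⬝ᵥ φ) := by
    rw [star_mulVec, conjTranspose_conjTranspose, ← dotProduct_mulVec, mulVec_mulVec, mulVec_mulVec,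
      hconj, add_mulVec, sub_mulVec, smul_mulVec, smul_mulVec, one_mulVec,
      totalNumber_mulVec_of_isInSector hφ, smul_smul, dotProduct_add, dotProduct_sub, dotProduct_smul,
      dotProduct_smul, smul_eq_mul, smul_eq_mul]
  rw [hnorm, hform, ThermodynamicLimit.star_dotProduct_self_eq_re φ] at h1
  simp only [Complex.add_re, Complex.sub_re, Complex.mul_re, Complex.ofReal_re, Complex.ofReal_im,
    Complex.natCast_re, Complex.natCast_im, mul_zero, sub_zero] at h1
  push_cast at h1 ⊢
  nlinarith [h1]

end Symmetry

/-! ### The plaquette: the three-electron ceiling and the exact odd floors -/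

/-- `1 ≤ |PlaquetteSite| = 4`. [folklore] -/
theorem card_plaquetteSite_ge_one : 1 ≤ Fintype.card PlaquetteSite := by rw [card_plaquetteSite]; omega

/-- `szSector (2 + 1) ((2 − 1)/2) = szSector 3 ½` on the plaquette. [folklore] -/
theorem szSector_two_one :
    (szSector (2 + 1) ((((2 : ℕ) : ℝ) - ((1 : ℕ) : ℝ)) / 2) :
        Submodule ℂ (Fock (Orb PlaquetteSite))) = szSector 3 (1 / 2) := by
  norm_num

/-- **Upper bound on `e₃^½`** by an integer trial array in the sector `(2,1)` of the `Fin 4` model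
(variational principle, transported along `Γ`). [folklore] -/
theorem minEnergyOn_three_le (U : ℝ) (v : Fin 6 → Fin 4 → ℤ) (hv : 0 < nsqZ v) :
    (plaquetteHamiltonian U).minEnergyOn (szSector 3 (1 / 2)) ≤
      (hopZ K2 K1 v + U * dblZ d21 v) / nsqZ v := by
  set ψ : Fock (Orb (Fin 4)) := ofSectorArray s2 s1 (fun i j => ((v i j : ℤ) : ℂ)) with hψdef
  have hψ : IsInSector 2 1 ψ := isInSector_ofSectorArray isSubsetEnum_s2 isSubsetEnum_s1 _
  have hw : w21 ψ = fun i j => ((v i j : ℤ) : ℂ) :=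
    funext fun i => funext fun j => coeffMatrix_ofSectorArray isSubsetEnum_s2 isSubsetEnum_s1 _ i j
  obtain ⟨hn, hH⟩ := sector21_forms U hψ
  rw [hw, normSqW_intCast] at hn
  rw [hw, hopForm_intCast, dblForm_intCast] at hH
  have hχ : IsInSector 2 1 (gam *ᵥ ψ) := isInSector_relabelMatrix_mulVec siteEquiv hψ
  obtain ⟨hexp, hnorm⟩ := expect_push U ψ
  have hbd := (upDownSector_groundState plaquetteGraph 1 U two_le_card_plaquetteSite'
    card_plaquetteSite_ge_one).2 (gam *ᵥ ψ) hχ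
  rw [szSector_two_one, Literature.MathematicalPhysics.QuantumLattice.expect,
    show hamiltonian plaquetteGraph 1 U = plaquetteHamiltonian U from rfl, hexp, hnorm, hn, hH] at hbd
  rw [le_div_iff₀ (by exact_mod_cast hv)]
  simpa using hbd

/-- **The three-electron ceiling** `e₃^½(U) ≤ (−55 + 4U)/15` (`≤ −2.6` on `[2, 4]`) from the
integer trial array below (the `U = 4` sector ground state rounded at scale `3`; its integers
`hopZ = −220`, `dblZ = 16`, `nsqZ = 60` by `decide`). [folklore] -/
theorem e3_le_trial (U : ℝ) :
    (plaquetteHamiltonian U).minEnergyOn (szSector 3 (1 / 2)) ≤ (-55 + 4 * U) / 15 := by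
  have e :
      hopZ K2 K1 ![![1, 1, 2, 2], ![1, 2, 1, 1], ![2, 3, 3, 2], ![0, 0, 0, 0], ![1, 1, 2, 1], ![2, 2, 1, 1]]
          = -220 ∧
        dblZ d21 ![![1, 1, 2, 2], ![1, 2, 1, 1], ![2, 3, 3, 2], ![0, 0, 0, 0], ![1, 1, 2, 1], ![2, 2, 1, 1]]
          = 16 ∧
        nsqZ (![![1, 1, 2, 2], ![1, 2, 1, 1], ![2, 3, 3, 2], ![0, 0, 0, 0], ![1, 1, 2, 1], ![2, 2, 1, 1]] :
          Fin 6 → Fin 4 → ℤ) = 60 := by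
    decide +kernel
  have h := minEnergyOn_three_le U
    ![![1, 1, 2, 2], ![1, 2, 1, 1], ![2, 3, 3, 2], ![0, 0, 0, 0], ![1, 1, 2, 1], ![2, 2, 1, 1]]
    (by rw [e.2.2]; decide)
  rw [e.1, e.2.1, e.2.2] at h
  push_cast at h
  linarith

/-- **A `U`-uniform floor** `−3.211 ≤ e₃^½(U)` for `U ≥ 2` (the certificate `form21_lb_0` at `U = 2`
and monotonicity of the form in `U`). [folklore] -/
theorem e3_ge_uniform {U : ℝ} (hU2 : 2 ≤ U) :
    (-3211 / 1000 : ℝ) ≤ (plaquetteHamiltonian U).minEnergyOn (szSector 3 (1 / 2)) :=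
  le_minEnergyOn_three U _ fun x => formBound_mono form21_lb_0 hU2 x

section Plaquette

variable (U : ℝ)

/-- Sector `(2,1)`: the variational floor `e₃^½ ‖v‖² ≤ Re⟨v, H v⟩` (definition of the sector energy).
[folklore] -/
theorem plaq21_floor (v : Fock (Orb PlaquetteSite)) (hv : IsInSector 2 1 v) :
    (plaquetteHamiltonian U).minEnergyOn (szSector 3 (1 / 2)) * (star v ⬝ᵥ v).re ≤
      (star v ⬝ᵥ (plaquetteHamiltonian U *ᵥ v)).re := by
  have h := (upDownSector_groundState plaquetteGraph 1 U two_le_card_plaquetteSite'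
    card_plaquetteSite_ge_one).2 v hv
  rw [szSector_two_one, Literature.MathematicalPhysics.QuantumLattice.expect] at h
  exact h

/-- Sector `(2,2)`: the variational floor `e₄⁰ ‖v‖² ≤ Re⟨v, H v⟩`. [folklore] -/
theorem plaq22_floor (v : Fock (Orb PlaquetteSite)) (hv : IsInSector 2 2 v) :
    (plaquetteHamiltonian U).minEnergyOn (szSector 4 0) * (star v ⬝ᵥ v).re ≤
      (star v ⬝ᵥ (plaquetteHamiltonian U *ᵥ v)).re := by
  have h := (upDownSector_groundState plaquetteGraph 1 U two_le_card_plaquetteSite'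
    two_le_card_plaquetteSite').2 v hv
  have hs : (szSector (2 + 2) ((((2 : ℕ) : ℝ) - ((2 : ℕ) : ℝ)) / 2) :
      Submodule ℂ (Fock (Orb PlaquetteSite))) = szSector 4 0 := by norm_num
  rw [hs, Literature.MathematicalPhysics.QuantumLattice.expect] at h
  exact h

/-- Sector `(1,2)`: the same floor `e₃^½` by spin exchange. [folklore] -/
theorem plaq12_floor (v : Fock (Orb PlaquetteSite)) (hv : IsInSector 1 2 v) :
    (plaquetteHamiltonian U).minEnergyOn (szSector 3 (1 / 2)) * (star v ⬝ᵥ v).re ≤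
      (star v ⬝ᵥ (plaquetteHamiltonian U *ᵥ v)).re :=
  sectorFormBound_spinSwap plaquetteGraph 1 U (plaq21_floor U) v hv

/-- Sector `(2,3)`: the floor `e₃^½ + U`, the particle–hole image of `(2,1)` (the plaquette, the torus
of even side `2`, carries the bipartite sign `torusStagger`). [folklore] -/
theorem plaq23_floor (v : Fock (Orb PlaquetteSite)) (hv : IsInSector 2 3 v) :
    ((plaquetteHamiltonian U).minEnergyOn (szSector 3 (1 / 2)) + U) * (star v ⬝ᵥ v).re ≤
      (star v ⬝ᵥ (plaquetteHamiltonian U *ᵥ v)).re := by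
  have h := sectorFormBound_particleHole plaquetteGraph 1 U torusStagger
    (fun _ _ hxy => torusStagger_eq_neg_of_adj_holds ⟨1, rfl⟩ hxy) (a := 2) (b := 3)
    (E := (plaquetteHamiltonian U).minEnergyOn (szSector 3 (1 / 2)))
    (fun ψ hψ => plaq21_floor U ψ (by rw [card_plaquetteSite] at hψ; simpa using hψ)) v hv
  rw [card_plaquetteSite] at h
  refine formBound_weaken (le_of_eq ?_) h
  push_cast
  ring

/-- Sector `(3,2)`: the floor `e₃^½ + U`, the particle–hole image of `(1,2)`. [folklore] -/
theorem plaq32_floor (v : Fock (Orb PlaquetteSite)) (hv : IsInSector 3 2 v) :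
    ((plaquetteHamiltonian U).minEnergyOn (szSector 3 (1 / 2)) + U) * (star v ⬝ᵥ v).re ≤
      (star v ⬝ᵥ (plaquetteHamiltonian U *ᵥ v)).re := by
  have h := sectorFormBound_particleHole plaquetteGraph 1 U torusStagger
    (fun _ _ hxy => torusStagger_eq_neg_of_adj_holds ⟨1, rfl⟩ hxy) (a := 3) (b := 2)
    (E := (plaquetteHamiltonian U).minEnergyOn (szSector 3 (1 / 2)))
    (fun ψ hψ => plaq12_floor U ψ (by rw [card_plaquetteSite] at hψ; simpa using hψ)) v hv
  rw [card_plaquetteSite] at h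
  refine formBound_weaken (le_of_eq ?_) h
  push_cast
  ring

/-- `Re⟨v, (h − μN) v⟩ = Re⟨v, h v⟩ − μ(a + b)‖v‖²` on the sector `(a, b)`. [folklore] -/
theorem re_gcForm_of_isInSector (μ : ℝ) {a b : ℕ} {v : Fock (Orb PlaquetteSite)}
    (hv : IsInSector a b v) :
    (star v ⬝ᵥ ((plaquetteHamiltonian U - (μ : ℂ) • totalNumber) *ᵥ v)).re =
      (star v ⬝ᵥ (plaquetteHamiltonian U *ᵥ v)).re
        - μ * ((a + b : ℕ) : ℝ) * (star v ⬝ᵥ v).re := by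
  rw [sub_mulVec, smul_mulVec, totalNumber_mulVec_of_isInSector hv, smul_smul, dotProduct_sub,
    dotProduct_smul, smul_eq_mul, Complex.sub_re, ThermodynamicLimit.star_dotProduct_self_eq_re v]
  simp only [Complex.mul_re, Complex.ofReal_re, Complex.ofReal_im, Complex.natCast_re,
    Complex.natCast_im, mul_zero, sub_zero]

end Plaquette

/-! ### The three clauses -/

/-- **(ii) in sector form**: `(e₃^½ + (U/2)(a + b − 3))‖v‖² ≤ Re⟨v, H v⟩` on every odd sector `(a, b)`
of the plaquette, `U ∈ [2, 4]`. [folklore] -/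
theorem oddFloor_sector {U : ℝ} (hU2 : 2 ≤ U) (hU4 : U ≤ 4) :
    ∀ a b : ℕ, ¬ Even (a + b) → ∀ v : Fock (Orb (FermionTorus 2 2)), IsInSector a b v →
      ((plaquetteHamiltonian U).minEnergyOn (szSector 3 (1 / 2)) + U / 2 * (((a + b : ℕ) : ℝ) - 3)) *
          (star v ⬝ᵥ v).re ≤ (star v ⬝ᵥ (plaquetteHamiltonian U *ᵥ v)).re := by
  intro a b hab v hv
  by_cases hv0 : v = 0
  · subst hv0; simp
  obtain ⟨ha, hb⟩ := le_card_of_isInSector hv hv0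
  rw [card_fermionTorus_two_two] at ha hb
  have e3 := e3_le_trial U
  interval_cases a <;> interval_cases b
  · exact absurd (by decide) hab
  · exact formBound_weaken (by push_cast; linarith) (plaq01_lb hU2 v hv)
  · exact absurd (by decide) hab
  · exact formBound_weaken (by push_cast; linarith) (plaq03_lb hU2 v hv)
  · exact absurd (by decide) hab
  · exact formBound_weaken (by push_cast; linarith) (plaq10_lb hU2 v hv)
  · exact absurd (by decide) hab
  · exact formBound_weaken (by push_cast; linarith) (plaq12_floor U v hv)
  · exact absurd (by decide) hab
  · exact formBound_weaken (by push_cast; linarith) (plaq14_lb hU2 hU4 v hv)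
  · exact absurd (by decide) hab
  · exact formBound_weaken (by push_cast; linarith) (plaq21_floor U v hv)
  · exact absurd (by decide) hab
  · exact formBound_weaken (by push_cast; linarith) (plaq23_floor U v hv)
  · exact absurd (by decide) hab
  · exact formBound_weaken (by push_cast; linarith) (plaq30_lb hU2 v hv)
  · exact absurd (by decide) hab
  · exact formBound_weaken (by push_cast; linarith) (plaq32_floor U v hv)
  · exact absurd (by decide) hab
  · exact formBound_weaken (by push_cast; linarith) (plaq34_lb hU2 hU4 v hv)
  · exact absurd (by decide) hab
  · exact formBound_weaken (by push_cast; linarith) (plaq41_lb hU2 hU4 v hv)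
  · exact absurd (by decide) hab
  · exact formBound_weaken (by push_cast; linarith) (plaq43_lb hU2 hU4 v hv)
  · exact absurd (by decide) hab

/-- **(i) The grand-canonical floor at `μ = U/2`**: `(e₄⁰ − 2U)‖v‖² ≤ Re⟨v, (h − (U/2)N) v⟩` on every
sector of the plaquette. [folklore] -/
theorem gcFloor_halfFilling {U : ℝ} (hU2 : 2 ≤ U) (hU4 : U ≤ 4) :
    ∀ a b : ℕ, ∀ v : Fock (Orb (FermionTorus 2 2)), IsInSector a b v →
      ((hubbardTorus 2 2 1 U).minEnergyOn (szSector 4 0) - 2 * U) * (star v ⬝ᵥ v).re ≤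
        (star v ⬝ᵥ ((hubbardTorus 2 2 1 U - ((U / 2 : ℝ) : ℂ) • totalNumber) *ᵥ v)).re := by
  intro a b v hv
  rw [← plaquetteHamiltonian_eq_hubbardTorus, re_gcForm_of_isInSector U (U / 2) hv]
  have hn := normSq_re_nonneg v
  by_cases hab : (a, b) = (2, 2)
  · obtain ⟨rfl, rfl⟩ := Prod.mk.inj hab
    have h := plaq22_floor U v hv
    push_cast
    nlinarith [h, hn]
  · have h := gcWindow_offSector hU2 hU4 a b hab v hv
    rw [← plaquetteHamiltonian_eq_hubbardTorus] at h
    nlinarith [h, hn]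

/-- **(ii) The odd-sector floor at `μ = U/2`**: `(e₃^½ − 3U/2)‖v‖² ≤ Re⟨v, (h − (U/2)N) v⟩` on every
odd sector of the plaquette, `U ∈ [2, 4]`. [folklore] -/
theorem oddFloor_halfFilling {U : ℝ} (hU2 : 2 ≤ U) (hU4 : U ≤ 4) :
    ∀ a b : ℕ, ¬ Even (a + b) → ∀ v : Fock (Orb (FermionTorus 2 2)), IsInSector a b v →
      ((hubbardTorus 2 2 1 U).minEnergyOn (szSector 3 (1 / 2)) - 3 * (U / 2)) * (star v ⬝ᵥ v).re ≤
        (star v ⬝ᵥ ((hubbardTorus 2 2 1 U - ((U / 2 : ℝ) : ℂ) • totalNumber) *ᵥ v)).re := by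
  intro a b hab v hv
  rw [← plaquetteHamiltonian_eq_hubbardTorus, re_gcForm_of_isInSector U (U / 2) hv]
  have h := oddFloor_sector hU2 hU4 a b hab v hv
  nlinarith [h]

/-- **(iii) The holon doublet lies above the chemical potential**: `e₄⁰ − U/2 < e₃^½` for `U ≥ 2`
(margin `≥ 0.55`). [folklore] -/
theorem e4_sub_half_lt_e3 {U : ℝ} (hU2 : 2 ≤ U) :
    (hubbardTorus 2 2 1 U).minEnergyOn (szSector 4 0) - U / 2 <
      (hubbardTorus 2 2 1 U).minEnergyOn (szSector 3 (1 / 2)) := by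
  rw [← plaquetteHamiltonian_eq_hubbardTorus]
  have h4 := e4_le_2 U
  have h3 := e3_ge_uniform hU2
  linarith

/-! ### The stub -/

/-- **Stub OF of the line `CooperPairDMott/birth` — the odd-sector floor of the plaquette at
`μ = U/2`** (plaquette datum of the holon floor; certified computation plus the two exact
symmetries). For `U ∈ [2,4]` and `h = hubbardTorus 2 2 1 U`: (i) `Re⟨v,(h − (U/2)N)v⟩ ≥ (e₄ − 2U)‖v‖²`
on every `(N↑,N↓)` sector (the 4-electron singlet is a grand-canonical ground state at the
particle–hole symmetric chemical potential); (ii) `≥ (e₃ − 3U/2)‖v‖²` on every ODD sector (the holon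
doublet `(2,1)` realises the minimum: tautological there, spin exchange for `(1,2)`, particle–hole
conjugation for `(2,3)`, `(3,2)`, Gershgorin floors against the trial ceiling `e₃ ≤ −2.6` elsewhere);
(iii) `e₄ − U/2 < e₃`. Tsai–Kivelson, PRB 73 (2006) 214510, Table I (plaquette spectra, orientation).
[cite: TsaiKivelson2006, Table I] -/
theorem stub_plaquetteOddSectorFloor :
    ∀ U ∈ Set.Icc (2 : ℝ) 4,
      (∀ a b : ℕ, ∀ v : Fock (Orb (FermionTorus 2 2)), IsInSector a b v →
        ((hubbardTorus 2 2 1 U).minEnergyOn (szSector 4 0) - 2 * U) * (star v ⬝ᵥ v).re ≤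
          (star v ⬝ᵥ ((hubbardTorus 2 2 1 U - ((U / 2 : ℝ) : ℂ) • totalNumber) *ᵥ v)).re) ∧
      (∀ a b : ℕ, ¬ Even (a + b) → ∀ v : Fock (Orb (FermionTorus 2 2)), IsInSector a b v →
        ((hubbardTorus 2 2 1 U).minEnergyOn (szSector 3 (1 / 2)) - 3 * (U / 2)) * (star v ⬝ᵥ v).re ≤
          (star v ⬝ᵥ ((hubbardTorus 2 2 1 U - ((U / 2 : ℝ) : ℂ) • totalNumber) *ᵥ v)).re) ∧
      (hubbardTorus 2 2 1 U).minEnergyOn (szSector 4 0) - U / 2 <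
        (hubbardTorus 2 2 1 U).minEnergyOn (szSector 3 (1 / 2)) := by
  intro U hU
  exact ⟨gcFloor_halfFilling hU.1 hU.2, oddFloor_halfFilling hU.1 hU.2, e4_sub_half_lt_e3 hU.1⟩

end Summit.HubbardSuperconductivity.HubbardSuperconductivity.Theorems.CooperPairDMottWalk

end
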